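import Summits.BirchSwinnertonDyer.BirchSwinnertonDyer.Theorems.ClassRecordThreeEulerHalvesAtThreeWalkSupplyGross1991Scoped
import Summits.BirchSwinnertonDyer.BirchSwinnertonDyer.Theorems.ErratumRoadFiveNonSurjCornerKolyJSupplyLeavesAdm
import Summits.BirchSwinnertonDyer.BirchSwinnertonDyer.Theorems.KatoDescentTamePotSupersingularJetchevIrreducibleCoreVertexRootClass
import HarnessLib

/-!
# The walk's three receptacle consumers (carrier package, `hselmer` one level up, `hsel0` at a step) with ADMISSIBILITY AS
# A HYPOTHESIS — image-agnostic twins of tam3-p1's `…WalkSupplyGross1991Scoped` for the non-surjective corner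
# (cell `bsd-stepL`, seat `bsd-stepL-corner-p1` g11; `--supports stmt-BirchSwinnertonDyer-19947`)

WHY. `exists_carrierPackage_kolyvagin`, `rootClass_mem_selmerGroup_selmerF_of_levelUp_kolyvagin` and
`kolyvaginClass_mem_selmerGroup_selmerF0_relaxedAt_kolyvagin` (tam3 g8, helper toward 19109) are the three consumers of
[GZ86 III (3.1)] in tam3's discharge of the walk's Selmer supply; each takes `ρ̄_{E,p}` ONTO and uses it only through the
Kummer ∕ root-class leaves, i.e. for the admissibility of `E(K[m]) ⊆ E(K̄)`. THIS FILE: the same three theorems with the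
admissibility explicit (`hA`, `hAku`) and the leaves replaced by their `_of_admissible` twins (bsd-potss `JetchevIrreducibleCoreVertex.…` for the root class,
`…KolyJSupplyLeavesAdm` for the Kummer places of `c_k(c)`);
proofs otherwise tam3's verbatim. On the corner the binders are fed by x11b3's
`NoTorsionIrr.isAdmissible_pointsSubgroup_of_hasIrreducibleModPGaloisRep`. HONEST FRAMING: three theorems, no definition ∕
fact ∕ sorry; `hGZ'`∕`hGZ` ([GZ86 III (3.1)] receptacle, Kolyvagin-scoped), `hΦ`, `h49str` stay hypotheses exactly as in
tam3's file; nothing about any curve; no stub closes; BSD is not advanced; T7. Credit: tam3-p1 (and bsd-jet's leaves).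
References (locators only): [cite: Jetchev2008, Lemma 3.2, §3.1 item 7, Prop. 4.5–4.6, Prop. 4.9, (δ) (pp. 814–822)]
[cite: GrossLMS1991, §3 (3.1), §6 Prop. 6.2 (1)] [cite: GrossZagier1986, III (3.1)] [cite: Howard2004HeegnerKolyvagin, Lemma 2.7.3].
-/

set_option autoImplicit false

noncomputable section

open scoped Classical Pointwise
open Function NumberField IsDedekindDomain WeierstrassCurve Field
open Literature.NumberTheory.EllipticCurves Literature.NumberTheory.GaloisRepresentations
open Literature.NumberTheory.EllipticCurves.Jetchev2008 Literature.NumberTheory.EllipticCurves.KolyvaginCocycle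
open Literature.NumberTheory.EllipticCurves.ModularForms
open Literature.NumberTheory.GaloisCohomology Literature.NumberTheory.Automorphic
open Literature.NumberTheory.GaloisRepresentations.DiscreteGaloisModule (transverseSubgroup SelmerStructure)
open Summit.BirchSwinnertonDyer.Rank1Residual.JET.SelmerVocabulary
open Summit.BirchSwinnertonDyer.Rank1Residual.JET.GlobalDuality
open Summit.BirchSwinnertonDyer.Rank1Residual.X11b
open Summit.BirchSwinnertonDyer.BirchSwinnertonDyer.Theorems

namespace Summit.BirchSwinnertonDyer.Rank1Residual.JET.Walk

/-! ### The carrier package -/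

section Carrier

variable (W : WeierstrassCurve ℚ) [W.IsElliptic] [W.IsGloballyMinimal] [NeZero (W.conductorNorm ℤ)]
  (K : Type) [Field K] [NumberField K]

/-- (Admissibility at Kolyvagin conductors as hypothesis `hA`; image-agnostic twin for the non-surjective corner.)
**The carrier package with [GZ86 III (3.1)] asked ONLY at Kolyvagin conductors** —
`exists_carrierPackage` (p525655) VERBATIM except that the receptacle hypothesis `hGZ'` is scoped to
square-free `m` whose prime factors are Zhang–Kolyvagin primes (the printed scope of Gross 1991 §3 (3.1);
the shape bsd-jet's `JET.forall_hGZ_of_Gross1991` DERIVES from the Literature fact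
`Gross1991_heegnerPoint_sub_ratTorsion_mem_E0`), the Kummer leaf being bsd-jet's scoped twin
`JET.localization_kolyvaginClass_mem_kummerSelmerStructure_of_GZ31_kolyvagin`.
[cite: Jetchev2008, Lemma 3.2, Prop. 4.9, (δ) (pp. 814–822)] [cite: GrossLMS1991, §3 (3.1), §6 Prop. 6.2 (1)]
[cite: GrossZagier1986, III (3.1)] -/
theorem exists_carrierPackage_kolyvagin_of_admissible (hK : IsImaginaryQuadratic K)
    (hD3 : NumberField.discr K ≠ -3) (hD4 : NumberField.discr K ≠ -4) (τ : K ≃ₐ[ℚ] K) (hτ : τ ≠ 1)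
    (hHN : SatisfiesHeegnerHypothesis (W.conductorNorm ℤ) K) (p : ℕ) [Fact p.Prime] (hp2 : p ≠ 2)
    (hpN : p ∣ W.conductorNorm ℤ)
    (Dt : ModularParametrizationData W (W.conductorNorm ℤ)) (β : ℤ) (ι : K →+* ℂ)
    [∀ j : ℕ, NumberField (ringClassField K ι j)]
    {n' : ℤ} (hcop' : IsCoprime (p : ℤ) n')
    (hGZ' : ∀ (m : ℕ), Squarefree m →
      (∀ q ∈ m.primeFactors, Zhang2014.IsKolyvaginPrime (W.conductorNorm ℤ) W K p q) →
      ∀ (dm : KolyvaginHeegnerData Dt β ι m)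
      (γ : ringClassField K ι m ≃ₐ[ℚ] ringClassField K ι m), γ ∈ ringClassGal ι m →
      ∀ v : HeightOneSpectrum (𝓞 K), ¬ (W.baseChange K).HasGoodReductionAt v →
        n' • pointsMap (W.baseChange K) (v.adicCompletion K)
            (dm.toGeomPoints (pointGalHom W (ringClassField K ι m) γ dm.y)) ∈
          E0Receptacle (W.baseChange K) v ∧
        ∀ (ℓ : ℕ), ℓ ∈ m.primeFactors → ∀ (dm' : KolyvaginHeegnerData Dt β ι (m / ℓ))
          (hle : ringClassField K ι (m / ℓ) ≤ ringClassField K ι m),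
          n' • pointsMap (W.baseChange K) (v.adicCompletion K)
              (dm.toGeomPoints (pointGalHom W (ringClassField K ι m) γ
                (WeierstrassCurve.Affine.Point.map (W' := W)
                  ((RingClassField.inclusion ι hle).restrictScalars ℚ) dm'.y))) ∈
            E0Receptacle (W.baseChange K) v)
    (hΦ : ∀ (W : WeierstrassCurve ℚ) [W.IsElliptic] [W.IsGloballyMinimal] (ℓ p : ℕ) [Fact ℓ.Prime]
      [Fact p.Prime], p ≠ 2 → p ∣ (W.baseChange ℚ_[ℓ]).localTamagawaNumber ℤ_[ℓ] →
      ∀ [(W.baseChange ℚ_[ℓ]).IsMinimal ℤ_[ℓ]],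
      IsAddCyclic ((W.baseChange ℚ_[ℓ]).toAffine.Point ⧸ (W.baseChange ℚ_[ℓ]).goodReductionSubgroup ℤ_[ℓ]))
    (v : HeightOneSpectrum (𝓞 ℚ)) (k : ℕ) (hn : ((p ^ k : ℕ) : ℤ) ≠ 0)
    (htk : padicValNat p (W.tamagawaNumberAt v) ≤ k)
    (hA : ∀ (m : ℕ) (dm : KolyvaginHeegnerData Dt β ι m), Squarefree m →
      (∀ q ∈ m.primeFactors, Zhang2014.IsKolyvaginPrime (W.conductorNorm ℤ) W K p q) →
      IsAdmissible (absoluteGaloisGroup K) dm.pointsSubgroup ((p ^ k : ℕ) : ℤ))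
    (h49str : ∀ (c : ℕ), Squarefree c →
        (∀ ℓ ∈ c.primeFactors, Zhang2014.IsKolyvaginPrime (W.conductorNorm ℤ) W K p ℓ ∧
          k ≤ Zhang2014.kolyvaginIndex W p ℓ) →
      ∀ (q : HeightOneSpectrum (𝓞 K)), ((W.conductorNorm ℤ : ℕ) : 𝓞 K) ∈ q.asIdeal →
      ∀ (ℓ : ℕ), Zhang2014.IsKolyvaginPrime (W.conductorNorm ℤ) W K p ℓ →
        k ≤ Zhang2014.kolyvaginIndex W p ℓ → ℓ ∉ c.primeFactors →
      ∀ (d' : KolyvaginHeegnerData Dt β ι (c * ℓ)),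
        galoisCohomology.localization ((W.baseChange K).torsionGaloisModule ((p ^ k : ℕ) : ℤ))
            (Sum.inr q) 1 (d'.kolyvaginClass (Fact.out : p.Prime) k) ∈ stringentFamily W K hn (Sum.inr q)) :
    ∃ (𝒮 : SelmerStructure ((W.baseChange K).torsionGaloisModule ((p ^ k : ℕ) : ℤ)))
      (v₀ : HeightOneSpectrum (𝓞 K)),
      (∀ w, 𝒮 w ≤ (W.baseChange K).kummerSelmerStructure ((p ^ k : ℕ) : ℤ) w) ∧
      τ • v₀ ≠ v₀ ∧ ((W.conductorNorm ℤ : ℕ) : 𝓞 K) ∈ v₀.asIdeal ∧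
      ((W.conductorNorm ℤ : ℕ) : 𝓞 K) ∈ (τ • v₀).asIdeal ∧
      (∀ (v w : HeightOneSpectrum (𝓞 K)) (h : τ • v = w), v ∈ ({v₀, τ • v₀} : Finset _) →
        ∀ x : galoisCohomology (((W.baseChange K).torsionGaloisModule ((p ^ k : ℕ) : ℤ)).toLocal
          (Sum.inr v : Place K)) 1,
        x ∈ 𝒮 (Sum.inr v) → conjActPlace W τ ((p ^ k : ℕ) : ℤ) h x ∈ 𝒮 (Sum.inr w)) ∧
      IsAddCyclic (↥((W.baseChange K).kummerSelmerStructure ((p ^ k : ℕ) : ℤ) (Sum.inr v₀)) ⧸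
        (𝒮 (Sum.inr v₀)).addSubgroupOf
          ((W.baseChange K).kummerSelmerStructure ((p ^ k : ℕ) : ℤ) (Sum.inr v₀))) ∧
      (𝒮 (Sum.inr v₀)).relIndex ((W.baseChange K).kummerSelmerStructure ((p ^ k : ℕ) : ℤ) (Sum.inr v₀)) =
        p ^ padicValNat p (W.tamagawaNumberAt v) ∧
      (∀ q ∈ ({v₀, τ • v₀} : Finset (HeightOneSpectrum (𝓞 K))),
        ∀ (c : ℕ), Squarefree c →
        (∀ ℓ ∈ c.primeFactors, Zhang2014.IsKolyvaginPrime (W.conductorNorm ℤ) W K p ℓ ∧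
          k ≤ Zhang2014.kolyvaginIndex W p ℓ) →
        ∀ (ℓ : ℕ), Zhang2014.IsKolyvaginPrime (W.conductorNorm ℤ) W K p ℓ →
          k ≤ Zhang2014.kolyvaginIndex W p ℓ → ℓ ∉ c.primeFactors →
        ∀ (d' : KolyvaginHeegnerData Dt β ι (c * ℓ)),
          galoisCohomology.localization ((W.baseChange K).torsionGaloisModule ((p ^ k : ℕ) : ℤ))
            (Sum.inr q) 1 (d'.kolyvaginClass (Fact.out : p.Prime) k) ∈ 𝒮 (Sum.inr q)) := by
  by_cases ht : 1 ≤ padicValNat p (W.tamagawaNumberAt v)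
  · -- the stringent carrier over the prime under `v`
    obtain ⟨v₀, hv₀, hv₀N, hv₀N', hS, h𝒮σ, hcyc, hidx⟩ :=
      exists_stringentCarrier W K hK τ hτ hHN p hp2 hΦ v ht k hn htk
    refine ⟨stringentFamily W K hn, v₀, hS, hv₀, hv₀N, hv₀N', h𝒮σ, hcyc, hidx, ?_⟩
    intro q hq c hc hcK ℓ hℓK hkℓ hℓc d'
    have hqN : ((W.conductorNorm ℤ : ℕ) : 𝓞 K) ∈ q.asIdeal := by
      simp only [Finset.mem_insert, Finset.mem_singleton] at hq
      rcases hq with rfl | rfl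
      · exact hv₀N
      · exact hv₀N'
    exact h49str c hc hcK q hqN ℓ hℓK hkℓ hℓc d'
  · -- the degenerate Kummer carrier over `3 ∣ N`
    have ht0 : padicValNat p (W.tamagawaNumberAt v) = 0 := by omega
    obtain ⟨v₀, hv₀, hv₀N, hv₀N', hS, h𝒮σ, hcyc, hidx⟩ :=
      exists_kummerCarrier W K hK τ hτ hHN p hpN p k
    refine ⟨(W.baseChange K).kummerSelmerStructure ((p ^ k : ℕ) : ℤ), v₀, hS, hv₀, hv₀N, hv₀N', h𝒮σ,
      hcyc, by rw [hidx, ht0], ?_⟩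
    intro q hq c hc hcK ℓ hℓK hkℓ hℓc d'
    have hqN : ((W.conductorNorm ℤ : ℕ) : 𝓞 K) ∈ q.asIdeal := by
      simp only [Finset.mem_insert, Finset.mem_singleton] at hq
      rcases hq with rfl | rfl
      · exact hv₀N
      · exact hv₀N'
    -- the carrier place is not over a prime of `cℓ` (Kolyvagin primes are prime to `N`)
    have hℓ : ℓ.Prime := hℓK.1
    have hc0 : c ≠ 0 := hc.ne_zero
    have hcl : Squarefree (c * ℓ) :=
      (Nat.squarefree_mul ((Nat.Prime.coprime_iff_not_dvd hℓ).mpr fun h ↦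
        hℓc (Nat.mem_primeFactors.mpr ⟨hℓ, h, hc0⟩)).symm).mpr ⟨hc, hℓ.squarefree⟩
    have hpf : (c * ℓ).primeFactors = c.primeFactors ∪ {ℓ} := by
      rw [Nat.primeFactors_mul hc0 hℓ.ne_zero, hℓ.primeFactors]
    have hclK : ∀ l' ∈ (c * ℓ).primeFactors, Zhang2014.IsKolyvaginPrime (W.conductorNorm ℤ) W K p l' ∧
        k ≤ Zhang2014.kolyvaginIndex W p l' := by
      intro l' hl'
      rw [hpf, Finset.mem_union, Finset.mem_singleton] at hl'
      rcases hl' with h | rfl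
      · exact hcK l' h
      · exact ⟨hℓK, hkℓ⟩
    refine localization_kolyvaginClass_mem_kummerSelmerStructure_of_GZ31_kolyvagin_of_admissible hK hD3 hD4 hHN
      Dt β ι hcop' hGZ' hcl hclK d' (fun m hm dm ↦ hA m dm (hcl.squarefree_of_dvd hm)
        (fun q' hq' ↦ (hclK q' (Nat.primeFactors_mono hm hcl.ne_zero hq')).1)) (Sum.inr q) fun l' hl' hPO ↦ ?_
    obtain ⟨q', hqq, hq'⟩ := hPO
    cases hqq
    have hcopN : Nat.Coprime l' (W.conductorNorm ℤ) :=
      (Nat.Prime.coprime_iff_not_dvd (hclK l' hl').1.1).mpr (hclK l' hl').1.2.1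
    exact Literature.NumberTheory.NumberFields.Honda1971.natCast_notMem_of_coprime hcopN _ hq' hqN

end Carrier

/-! ### The Selmer memberships `hselmer` and `hsel0` -/

section Selmer

variable {K : Type} [Field K] [NumberField K] (W : WeierstrassCurve ℚ) [W.IsElliptic]
  [W.IsGloballyMinimal] [NeZero (W.conductorNorm ℤ)]
  {Dt : ModularParametrizationData W (W.conductorNorm ℤ)} {β : ℤ} {ι : K →+* ℂ}
  {p : ℕ} [Fact p.Prime] {k : ℕ} [∀ j : ℕ, NumberField (ringClassField K ι j)]
  {𝒯 : SelmerStructure ((W.baseChange K).torsionGaloisModule ((p ^ k : ℕ) : ℤ))}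
  (h𝒯 : ∀ v : HeightOneSpectrum (𝓞 K), 𝒯 (Sum.inr v) =
    ⨅ (ℓ : ℕ) (_ : ℓ.Prime ∧ (ℓ : 𝓞 K) ∈ v.asIdeal),
      ⨅ (w' : HeightOneSpectrum (𝓞 (ringClassField K ι ℓ)))
        (_ : w'.asIdeal.LiesOver v.asIdeal),
        letI := (adicCompletionOfLiesOver K (ringClassField K ι ℓ) v w').toAlgebra
        transverseSubgroup (GaloisRep.toLocal v ((W.baseChange K).torsionGaloisModule ((p ^ k : ℕ) : ℤ)))
          (w'.adicCompletion (ringClassField K ι ℓ)))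

include h𝒯 in
/-- (Admissibility for `p^{k+u}` at the divisors of `s` as hypotheses `hAku`/`hA`; image-agnostic twin.) **The supply's
`hselmer` at one conductor from bsd-jet's `htr` shape one level up, with [GZ86 III (3.1)] asked ONLY at Kolyvagin
conductors** — `rootClass_mem_selmerGroup_selmerF_of_levelUp` (p533160)
VERBATIM except for the Kolyvagin-scoped receptacle hypothesis `hGZ` and the scoped Kummer leaf.
[cite: Jetchev2008, §3.1 item 7 (p. 817), Prop. 4.5–4.6] [cite: GrossLMS1991, §3 (3.1), §6 Prop. 6.2 (1)]
[cite: GrossZagier1986, III (3.1)] [cite: Howard2004HeegnerKolyvagin, Lemma 2.7.3] -/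
theorem rootClass_mem_selmerGroup_selmerF_of_levelUp_kolyvagin_of_admissible (hK : IsImaginaryQuadratic K)
    (hD3 : NumberField.discr K ≠ -3) (hD4 : NumberField.discr K ≠ -4)
    (hH : SatisfiesHeegnerHypothesis (W.conductorNorm ℤ) K)
    {n' : ℤ} (hcop' : IsCoprime (p : ℤ) n')
    (hGZ : ∀ (m : ℕ), Squarefree m →
      (∀ q ∈ m.primeFactors, Zhang2014.IsKolyvaginPrime (W.conductorNorm ℤ) W K p q) →
      ∀ (dm : KolyvaginHeegnerData Dt β ι m)
      (γ : ringClassField K ι m ≃ₐ[ℚ] ringClassField K ι m), γ ∈ ringClassGal ι m →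
      ∀ v : HeightOneSpectrum (𝓞 K), ¬ (W.baseChange K).HasGoodReductionAt v →
        n' • pointsMap (W.baseChange K) (v.adicCompletion K)
            (dm.toGeomPoints (pointGalHom W (ringClassField K ι m) γ dm.y)) ∈
          E0Receptacle (W.baseChange K) v ∧
        ∀ (ℓ : ℕ), ℓ ∈ m.primeFactors → ∀ (dm' : KolyvaginHeegnerData Dt β ι (m / ℓ))
          (hle : ringClassField K ι (m / ℓ) ≤ ringClassField K ι m),
          n' • pointsMap (W.baseChange K) (v.adicCompletion K)
              (dm.toGeomPoints (pointGalHom W (ringClassField K ι m) γ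
                (WeierstrassCurve.Affine.Point.map (W' := W)
                  ((RingClassField.inclusion ι hle).restrictScalars ℚ) dm'.y))) ∈
            E0Receptacle (W.baseChange K) v)
    {s : ℕ} (hs : Squarefree s) {u : ℕ}
    (hsK : ∀ ℓ ∈ s.primeFactors, Zhang2014.IsKolyvaginPrime (W.conductorNorm ℤ) W K p ℓ ∧
      k + u ≤ Zhang2014.kolyvaginIndex W p ℓ)
    (d : KolyvaginHeegnerData Dt β ι s) (Q : (W.baseChange (ringClassField K ι s)).toAffine.Point)
    (hAk : IsAdmissible (absoluteGaloisGroup K) d.pointsSubgroup ((p ^ k : ℕ) : ℤ))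
    (hQ : d.toGeomPoints Q ∈ invPoints (absoluteGaloisGroup K) d.pointsSubgroup ((p ^ k : ℕ) : ℤ))
    (hQP : ((p ^ u : ℕ) : ℤ) • Q = d.derivedPoint)
    (hAku : IsAdmissible (absoluteGaloisGroup K) d.pointsSubgroup ((p ^ (k + u) : ℕ) : ℤ))
    (hA : ∀ (m : ℕ), m ∣ s → ∀ dm : KolyvaginHeegnerData Dt β ι m,
      IsAdmissible (absoluteGaloisGroup K) dm.pointsSubgroup ((p ^ (k + u) : ℕ) : ℤ))
    (hP : d.toGeomPoints d.derivedPoint ∈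
      invPoints (absoluteGaloisGroup K) d.pointsSubgroup ((p ^ (k + u) : ℕ) : ℤ))
    (htr : ∀ ℓ ∈ s.primeFactors,
      (d.kolyvaginClass (Fact.out : p.Prime) (k + u) :
        galoisCohomology ((W.baseChange K).torsionGaloisModule ((p ^ (k + u) : ℕ) : ℤ)) 1) ∈
        transverseKer W K ι ((p ^ (k + u) : ℕ) : ℤ) ℓ) :
    (kolyvaginClass (W.baseChange K) ((p ^ k : ℕ) : ℤ)
        ((W.baseChange K).zsmul_geomPoints_surjective_of_charZero
          (by exact_mod_cast pow_ne_zero k (Fact.out : p.Prime).ne_zero)) hAk (d.toGeomPoints Q) hQ) ∈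
      (selmerF W ((p ^ k : ℕ) : ℤ) 𝒯 (placesDividing K s)).selmerGroup := by
  have hp : p.Prime := Fact.out
  have hs0 : s ≠ 0 := hs.ne_zero
  -- Kummer condition at every place not over a prime of `s`, at level `k + u`, then pulled back
  have hKum : ∀ v : Place K, (∀ ℓ ∈ s.primeFactors, ¬ PlaceOver K v ℓ) →
      galoisCohomology.localization ((W.baseChange K).torsionGaloisModule ((p ^ k : ℕ) : ℤ)) v 1
        (kolyvaginClass (W.baseChange K) ((p ^ k : ℕ) : ℤ)
          ((W.baseChange K).zsmul_geomPoints_surjective_of_charZero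
            (by exact_mod_cast pow_ne_zero k hp.ne_zero)) hAk (d.toGeomPoints Q) hQ) ∈
        (W.baseChange K).kummerSelmerStructure ((p ^ k : ℕ) : ℤ) v := by
    intro v hv
    refine JetchevIrreducibleCoreVertex.localization_rootClass_mem_kummer_of_admissible W hp d k u hAku Q hAk hQ hQP hP v ?_
    exact localization_kolyvaginClass_mem_kummerSelmerStructure_of_GZ31_kolyvagin_of_admissible hK hD3 hD4 hH
      Dt β ι hcop' hGZ hs hsK d hA v hv
  exact (mem_selmerGroup_selmerF_iff W _ 𝒯 hs0 _).mpr
    ⟨hKum, JetchevIrreducibleCoreVertex.localization_rootClass_mem_globalTransverse_of_admissible W h𝒯 hK hs hsK d hAku Q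
      hAk hQ hQP hP htr⟩

include h𝒯 in
/-- (Admissibility for `p^k` at the divisors of `sℓ` as hypothesis `hA`; image-agnostic twin.) **The supply's `hsel0` at
one step `c_k(sℓ) ∈ H_{𝓕₀(s)^λ}`, with [GZ86 III (3.1)] asked ONLY at Kolyvagin conductors** — `kolyvaginClass_mem_selmerGroup_selmerF0_relaxedAt` (p524892) VERBATIM except for
the Kolyvagin-scoped receptacle hypothesis `hGZ` and the scoped Kummer leaf.
[cite: Jetchev2008, Prop. 4.6, Prop. 4.9 (pp. 819–820)] [cite: GrossLMS1991, §3 (3.1), §6 Prop. 6.2 (1)]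
[cite: GrossZagier1986, III (3.1)] [cite: Howard2004HeegnerKolyvagin, Lemma 2.7.3] -/
theorem kolyvaginClass_mem_selmerGroup_selmerF0_relaxedAt_kolyvagin_of_admissible (hK : IsImaginaryQuadratic K)
    (hD3 : NumberField.discr K ≠ -3) (hD4 : NumberField.discr K ≠ -4)
    (hH : SatisfiesHeegnerHypothesis (W.conductorNorm ℤ) K)
    {n' : ℤ} (hcop' : IsCoprime (p : ℤ) n')
    (hGZ : ∀ (m : ℕ), Squarefree m →
      (∀ q ∈ m.primeFactors, Zhang2014.IsKolyvaginPrime (W.conductorNorm ℤ) W K p q) →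
      ∀ (dm : KolyvaginHeegnerData Dt β ι m)
      (γ : ringClassField K ι m ≃ₐ[ℚ] ringClassField K ι m), γ ∈ ringClassGal ι m →
      ∀ v : HeightOneSpectrum (𝓞 K), ¬ (W.baseChange K).HasGoodReductionAt v →
        n' • pointsMap (W.baseChange K) (v.adicCompletion K)
            (dm.toGeomPoints (pointGalHom W (ringClassField K ι m) γ dm.y)) ∈
          E0Receptacle (W.baseChange K) v ∧
        ∀ (ℓ : ℕ), ℓ ∈ m.primeFactors → ∀ (dm' : KolyvaginHeegnerData Dt β ι (m / ℓ))
          (hle : ringClassField K ι (m / ℓ) ≤ ringClassField K ι m),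
          n' • pointsMap (W.baseChange K) (v.adicCompletion K)
              (dm.toGeomPoints (pointGalHom W (ringClassField K ι m) γ
                (WeierstrassCurve.Affine.Point.map (W' := W)
                  ((RingClassField.inclusion ι hle).restrictScalars ℚ) dm'.y))) ∈
            E0Receptacle (W.baseChange K) v)
    (𝒮 : SelmerStructure ((W.baseChange K).torsionGaloisModule ((p ^ k : ℕ) : ℤ)))
    (Qcar : Finset (HeightOneSpectrum (𝓞 K)))
    {s : ℕ} (hs : Squarefree s)
    (hsK : ∀ q ∈ s.primeFactors, Zhang2014.IsKolyvaginPrime (W.conductorNorm ℤ) W K p q ∧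
      k ≤ Zhang2014.kolyvaginIndex W p q)
    {ℓ : ℕ} (hℓK : Zhang2014.IsKolyvaginPrime (W.conductorNorm ℤ) W K p ℓ)
    (hkℓ : k ≤ Zhang2014.kolyvaginIndex W p ℓ) (hℓs : ¬ ℓ ∣ s)
    {m : ℕ} (hm : m = s * ℓ) (d' : KolyvaginHeegnerData Dt β ι m)
    (hA : ∀ (m' : ℕ), m' ∣ m → ∀ dm : KolyvaginHeegnerData Dt β ι m',
      IsAdmissible (absoluteGaloisGroup K) dm.pointsSubgroup ((p ^ k : ℕ) : ℤ))
    (v : HeightOneSpectrum (𝓞 K)) (hv : (ℓ : 𝓞 K) ∈ v.asIdeal)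
    (htr : ∀ q ∈ s.primeFactors,
      (d'.kolyvaginClass (Fact.out : p.Prime) k :
        galoisCohomology ((W.baseChange K).torsionGaloisModule ((p ^ k : ℕ) : ℤ)) 1) ∈
        transverseKer W K ι ((p ^ k : ℕ) : ℤ) q)
    (h𝒮Q : ∀ q ∈ Qcar,
      galoisCohomology.localization ((W.baseChange K).torsionGaloisModule ((p ^ k : ℕ) : ℤ))
          (Sum.inr q) 1 (d'.kolyvaginClass (Fact.out : p.Prime) k) ∈ 𝒮 (Sum.inr q)) :
    (d'.kolyvaginClass (Fact.out : p.Prime) k :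
        galoisCohomology ((W.baseChange K).torsionGaloisModule ((p ^ k : ℕ) : ℤ)) 1) ∈
      (((selmerF0 W ((p ^ k : ℕ) : ℤ) 𝒯 𝒮 (placesDividing K s) Qcar).relaxedAt {v}).selmerGroup) := by
  have hp : p.Prime := Fact.out
  subst hm
  have hs0 : s ≠ 0 := hs.ne_zero
  have hℓ : ℓ.Prime := hℓK.1
  -- the conductor `sℓ`
  have hcop : (ℓ).Coprime s := (Nat.Prime.coprime_iff_not_dvd hℓ).mpr hℓs
  have hsl : Squarefree (s * ℓ) := (Nat.squarefree_mul hcop.symm).mpr ⟨hs, hℓ.squarefree⟩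
  have hpf : (s * ℓ).primeFactors = s.primeFactors ∪ {ℓ} := by
    rw [Nat.primeFactors_mul hs0 hℓ.ne_zero, hℓ.primeFactors]
  have hslK : ∀ q ∈ (s * ℓ).primeFactors, Zhang2014.IsKolyvaginPrime (W.conductorNorm ℤ) W K p q ∧
      k ≤ Zhang2014.kolyvaginIndex W p q := by
    intro q hq
    rw [hpf, Finset.mem_union, Finset.mem_singleton] at hq
    rcases hq with h | rfl
    · exact hsK q h
    · exact ⟨hℓK, hkℓ⟩
  -- Kummer condition at every place not over a prime of `sℓ`
  have hKum : ∀ w : Place K, (∀ q ∈ (s * ℓ).primeFactors, ¬ PlaceOver K w q) →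
      galoisCohomology.localization ((W.baseChange K).torsionGaloisModule ((p ^ k : ℕ) : ℤ)) w 1
        (d'.kolyvaginClass hp k) ∈
        (W.baseChange K).kummerSelmerStructure ((p ^ k : ℕ) : ℤ) w := fun w hw ↦
    localization_kolyvaginClass_mem_kummerSelmerStructure_of_GZ31_kolyvagin_of_admissible hK hD3 hD4 hH Dt β ι
      hcop' hGZ hsl hslK d' hA w hw
  refine mem_relaxedAt_selmerF0_of_local W _ 𝒯 𝒮 hs0 Qcar v _ (fun w hws hwv _ ↦ hKum w ?_)
    (fun q hq _ ↦ h𝒮Q q hq) (fun w hw _ _ ↦ (globalTransverse_mem_iff h𝒯 hs _).mpr htr w hw)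
  -- a place not over `s` and not `λ` is not over `sℓ`
  intro q hq hPO
  rw [hpf, Finset.mem_union, Finset.mem_singleton] at hq
  rcases hq with h | rfl
  · exact hws q h hPO
  · obtain ⟨w', hww, hw'⟩ := hPO
    subst hww
    exact hwv (congrArg Sum.inr (place_eq_of_natCast_mem_of_isPrime hℓ.ne_zero hℓK.2.2.2.2.1 w' v hw' hv))

end Selmer

end Summit.BirchSwinnertonDyer.Rank1Residual.JET.Walk

end
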